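import Literature.Analysis.FluidPDE.DriftDiffusionMaxPrinciple
import HarnessLib

/-!
# StrainDoorsAlmostMax — S37 «StrainDoors» plate E2_S «StrainThreshold», ALMOST-MAXIMISER form (no decay)

The first-touch / supersolution device for the top Rayleigh quotient `sup_{x,|e|=1} ⟪W(t,x)e,e⟫` of a
BOUNDED (not necessarily decaying) operator field, with the growth hypothesis charged only at penalised
maximisers that are `(1−δ)`-almost maximisers above the threshold — twin of
`ArgmaxDoorsAlmostArgmax.norm_le_mul_exp_of_almostArgmax_inner_timeDeriv_le` (p648617) and of the exact form
`StrainDoorsThreshold.rayleigh_le_supersolution_of_argmax_growth` (p655218). For Navier–Stokes `W = ∇u`: the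
S33 frame bounds `∇u` on closed slabs but does not (pressure-free) give its uniform decay, so THIS is the
form in which the S37 threshold doors close unconditionally (LEAD frame notes, STATUS 2026-08-28 ≈18:4xZ).

* `rayleigh_le_supersolution_of_almostArgmax_growth`.

HONEST FRAME / WHAT THIS IS NOT: a tool for regularity CRITERIA about hypothetical blow-up (S-door lane, LEAD
ns-s30-p1 g3; `--supports stmt-NavierStokesRegularity-0056 --as helper`); item 0056 `NoTypeII` and NS
regularity are NOT proved; no PDE and no Literature fact inside; nothing here is a route or a summit statement.
-/

noncomputable section

open Set Function Filter Metric MeasureTheory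
open scoped RealInnerProductSpace Topology

set_option linter.dupNamespace false

namespace Summit.NavierStokesRegularity.NavierStokesRegularity.Theorems.ArgmaxDoors

open Literature.Analysis.FluidPDE

section AbstractStrainAlmost

variable {E : Type*} [NormedAddCommGroup E] [InnerProductSpace ℝ E] [FiniteDimensional ℝ E]

set_option maxHeartbeats 1600000 in
-- the penalised first-touch argument: four smallness conditions on the spatial weight, then compactness
/-- **Threshold comparison for the top Rayleigh quotient, charged only at ALMOST-maximisers — no decay
needed** (plate E2_S, almost-argmax form; twin of `norm_le_mul_exp_of_almostArgmax_inner_timeDeriv_le`).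
`W : [0,T] × E → (E →L E)` jointly `C^∞` and BOUNDED on the slab; `B > 0` continuous, `B' ≥ φB` within
`[0,T]`; `0 < δ < 1`; `η(ε) → 0` as `ε ↓ 0`. Suppose that for every `0 < ε ≤ 1`, every `t ∈ (0,T]` and every
unit `ē` and `x̄` such that `(x̄,ē)` maximises the PENALISED quotient `(1+ε|x|²)⁻¹⟪W(t,x)e,e⟫` over
`E × {|e|=1}`, is a `(1−δ)`-almost maximiser of `⟪W(t,x)e,e⟫`, and `⟪W(t,x̄)ē,ē⟫ > B(t)`:
`⟪∂ₜW(t,x̄)ē,ē⟫ ≤ (φ(t) + η(ε))⟪W(t,x̄)ē,ē⟫`. If `⟪W(0,·)e,e⟫ ≤ B(0)` then `⟪W(t,x)e,e⟫ ≤ B(t)` on the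
slab. (The penalised maximum is attained because the weight kills infinity; `ε` is chosen after the violating
point so that the penalised maximiser is an almost-maximiser and `η(ε)` is below the time weight.)
[cite: Friedman1964, Ch. 2 §4 Lemma 5 (the device); folklore] -/
theorem rayleigh_le_supersolution_of_almostArgmax_growth {T : ℝ} {W : ℝ → E → (E →L[ℝ] E)}
    (hW : IsSmoothSpaceTimeOn (Icc 0 T) W)
    (hbdd : ∃ K : ℝ, ∀ t ∈ Icc 0 T, ∀ x : E, ‖W t x‖ ≤ K)
    {B B' φ : ℝ → ℝ} (hBc : ContinuousOn B (Icc 0 T)) (hBpos : ∀ t ∈ Icc 0 T, 0 < B t)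
    (hBd : ∀ t ∈ Icc 0 T, HasDerivWithinAt B (B' t) (Icc 0 T) t)
    (hsuper : ∀ t ∈ Icc 0 T, φ t * B t ≤ B' t)
    {δ : ℝ} (hδ : 0 < δ) (hδ1 : δ < 1) {η : ℝ → ℝ} (hη : Tendsto η (𝓝[>] 0) (𝓝 0))
    (hgrow : ∀ ε : ℝ, 0 < ε → ε ≤ 1 → ∀ t ∈ Icc 0 T, 0 < t → ∀ (x₀ : E) (e₀ : E), ‖e₀‖ = 1 →
      (∀ (x : E) (e : E), ‖e‖ = 1 →
        (1 + ε * ‖x‖ ^ 2)⁻¹ * ⟪W t x e, e⟫ ≤ (1 + ε * ‖x₀‖ ^ 2)⁻¹ * ⟪W t x₀ e₀, e₀⟫) →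
      (∀ (x : E) (e : E), ‖e‖ = 1 → (1 - δ) * ⟪W t x e, e⟫ ≤ ⟪W t x₀ e₀, e₀⟫) →
      B t < ⟪W t x₀ e₀, e₀⟫ →
      ⟪timeDerivWithin (Icc 0 T) W t x₀ e₀, e₀⟫ ≤ (φ t + η ε) * ⟪W t x₀ e₀, e₀⟫)
    (hM : ∀ (x : E) (e : E), ‖e‖ = 1 → ⟪W 0 x e, e⟫ ≤ B 0) :
    ∀ t ∈ Icc 0 T, ∀ (x : E) (e : E), ‖e‖ = 1 → ⟪W t x e, e⟫ ≤ B t := by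
  by_cases hT : T < 0
  · intro t ht; exact absurd (ht.1.trans ht.2) (not_le.2 hT)
  push Not at hT
  have h0T : (0 : ℝ) ∈ Icc 0 T := ⟨le_rfl, hT⟩
  obtain ⟨tm, htm, hmin⟩ := (isCompact_Icc (a := (0 : ℝ)) (b := T)).exists_isMinOn ⟨0, h0T⟩ hBc
  set b : ℝ := B tm with hb
  have hbpos : 0 < b := hBpos tm htm
  have hBge : ∀ t ∈ Icc 0 T, b ≤ B t := fun t ht => isMinOn_iff.mp hmin t ht
  obtain ⟨K, hK⟩ := hbdd
  have hK0 : 0 ≤ K := (norm_nonneg _).trans (hK 0 h0T 0)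
  have hray : ∀ (L : E →L[ℝ] E) (e : E), ‖e‖ = 1 → ⟪L e, e⟫ ≤ ‖L‖ := fun L e he => by
    calc ⟪L e, e⟫ ≤ ‖L e‖ * ‖e‖ := real_inner_le_norm _ _
      _ ≤ ‖L‖ * ‖e‖ * ‖e‖ := by gcongr; exact L.le_opNorm e
      _ = ‖L‖ := by rw [he, mul_one, mul_one]
  have hqK : ∀ t ∈ Icc 0 T, ∀ (x : E) (e : E), ‖e‖ = 1 → ⟪W t x e, e⟫ ≤ K :=
    fun t ht x e he => (hray _ e he).trans (hK t ht x)
  by_contra hcon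
  push Not at hcon
  obtain ⟨t₁, ht₁, x₁, e₁, he₁, hlt⟩ := hcon
  have hB₁ : 0 < B t₁ := hBpos t₁ ht₁
  -- the violating point has `t₁ > 0`
  have ht₁pos : 0 < t₁ := by
    rcases ht₁.1.eq_or_lt with h | h
    · exfalso; rw [← h] at hlt; linarith [hM x₁ e₁ he₁]
    · exact h
  -- ### time weight `w(s) = e^{−2ε_t s}` with `w(t₁)q₁/B(t₁) > 1`
  set r : ℝ := ⟪W t₁ x₁ e₁, e₁⟫ / B t₁ with hr
  have hr1 : 1 < r := by rw [hr, lt_div_iff₀ hB₁, one_mul]; exact hlt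
  obtain ⟨εt, hεt0, hεt1⟩ : ∃ εt : ℝ, 0 < εt ∧ 1 < Real.exp (-(2 * εt * t₁)) * r := by
    have hc : Continuous fun ε : ℝ => Real.exp (-(2 * ε * t₁)) * r := by fun_prop
    have h0 : Tendsto (fun ε : ℝ => Real.exp (-(2 * ε * t₁)) * r) (𝓝[>] 0) (𝓝 r) := by
      have := (hc.tendsto 0).mono_left (nhdsWithin_le_nhds (s := Ioi (0 : ℝ)))
      simpa using this
    obtain ⟨ε, h1, h2⟩ := ((h0.eventually (lt_mem_nhds hr1)).and self_mem_nhdsWithin).exists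
    exact ⟨ε, h2, h1⟩
  set w : ℝ → ℝ := fun t => Real.exp (-(2 * εt * t)) with hw
  have hwpos : ∀ t, 0 < w t := fun t => Real.exp_pos _
  have hwle : ∀ t ∈ Icc (0 : ℝ) T, w t ≤ 1 := fun t ht => by
    rw [hw, Real.exp_le_one_iff]; nlinarith [ht.1, hεt0]
  set v₁ : ℝ := w t₁ * ⟪W t₁ x₁ e₁, e₁⟫ / B t₁ with hv₁
  have hv₁ : 1 < v₁ := by rw [hv₁, mul_div_assoc]; exact hεt1
  -- ### the supremum `S*` of the weighted quotient (finite: `W` bounded, `B ≥ b`)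
  set V : Set ℝ := {v | ∃ t ∈ Icc 0 T, ∃ (x : E) (e : E), ‖e‖ = 1 ∧ v = w t * ⟪W t x e, e⟫ / B t}
    with hV
  have hVbdd : BddAbove V := by
    refine ⟨K / b, ?_⟩
    rintro v ⟨t, ht, x, e, he, rfl⟩
    have hBt : 0 < B t := hBpos t ht
    rcases le_or_gt 0 ⟪W t x e, e⟫ with hq | hq
    · calc w t * ⟪W t x e, e⟫ / B t ≤ 1 * K / b := by
            rw [mul_div_assoc, mul_div_assoc]
            exact mul_le_mul (hwle t ht) (div_le_div₀ hK0 (hqK t ht x e he) hbpos (hBge t ht)) 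
              (div_nonneg hq hBt.le) zero_le_one
        _ = K / b := by rw [one_mul]
    · have : w t * ⟪W t x e, e⟫ / B t < 0 :=
        div_neg_of_neg_of_pos (mul_neg_of_pos_of_neg (hwpos t) hq) hBt
      have : 0 ≤ K / b := div_nonneg hK0 hbpos.le
      linarith
  have hv₁V : v₁ ∈ V := ⟨t₁, ht₁, x₁, e₁, he₁, rfl⟩
  set Sstar : ℝ := sSup V with hS
  have hS₁ : v₁ ≤ Sstar := le_csSup hVbdd hv₁V
  have hSpos : 0 < Sstar := (zero_lt_one.trans hv₁).trans_le hS₁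
  have hVle : ∀ t ∈ Icc 0 T, ∀ (x : E) (e : E), ‖e‖ = 1 → w t * ⟪W t x e, e⟫ / B t ≤ Sstar :=
    fun t ht x e he => le_csSup hVbdd ⟨t, ht, x, e, he, rfl⟩
  -- a point `(t₂,x₂,e₂)` with value `> (1 − δ/2)·S*`
  have hθ : (1 - δ / 2) * Sstar < Sstar := by nlinarith
  obtain ⟨v₂, hv₂V, hv₂⟩ := exists_lt_of_lt_csSup ⟨v₁, hv₁V⟩ hθ
  obtain ⟨t₂, ht₂, x₂, e₂, he₂, rfl⟩ := hv₂V
  -- ### choice of the spatial weight `ε`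
  set ρ : ℝ := (1 - δ) / (1 - δ / 2) with hρ
  have hρ1 : ρ < 1 := by rw [hρ, div_lt_one (by linarith)]; linarith
  have hρ0 : 0 < ρ := by rw [hρ]; exact div_pos (by linarith) (by linarith)
  obtain ⟨ε, hε0, hε1, hηε, hpen₁, hpen₂⟩ : ∃ ε : ℝ, 0 < ε ∧ ε ≤ 1 ∧ η ε < εt ∧
      1 < (1 + ε * ‖x₁‖ ^ 2)⁻¹ * v₁ ∧ ρ ≤ (1 + ε * ‖x₂‖ ^ 2)⁻¹ := by
    have h1 : ∀ᶠ ε in 𝓝[>] (0 : ℝ), ε ≤ 1 :=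
      mem_of_superset (Ioc_mem_nhdsGT zero_lt_one) fun ε hε => hε.2
    have h2 : ∀ᶠ ε in 𝓝[>] (0 : ℝ), η ε < εt := hη.eventually (gt_mem_nhds hεt0)
    have h3 : ∀ᶠ ε in 𝓝[>] (0 : ℝ), 1 < (1 + ε * ‖x₁‖ ^ 2)⁻¹ * v₁ := by
      have ht : Tendsto (fun ε : ℝ => (1 + ε * ‖x₁‖ ^ 2)⁻¹ * v₁) (𝓝 0)
          (𝓝 ((1 + 0 * ‖x₁‖ ^ 2)⁻¹ * v₁)) :=
        ((tendsto_const_nhds.add (tendsto_id.mul tendsto_const_nhds)).inv₀ (by simp)).mul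
          tendsto_const_nhds
      simp only [zero_mul, add_zero, inv_one, one_mul] at ht
      exact (ht.eventually (lt_mem_nhds hv₁)).filter_mono nhdsWithin_le_nhds
    have h4 : ∀ᶠ ε in 𝓝[>] (0 : ℝ), ρ ≤ (1 + ε * ‖x₂‖ ^ 2)⁻¹ := by
      have ht : Tendsto (fun ε : ℝ => (1 + ε * ‖x₂‖ ^ 2)⁻¹) (𝓝 0) (𝓝 ((1 + 0 * ‖x₂‖ ^ 2)⁻¹)) :=
        (tendsto_const_nhds.add (tendsto_id.mul tendsto_const_nhds)).inv₀ (by simp)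
      simp only [zero_mul, add_zero, inv_one] at ht
      exact ((ht.eventually (lt_mem_nhds hρ1)).filter_mono nhdsWithin_le_nhds).mono fun ε hε => hε.le
    obtain ⟨ε, ⟨⟨⟨⟨hh1, hh2⟩, hh3⟩, hh4⟩, hε0⟩⟩ :=
      ((((h1.and h2).and h3).and h4).and self_mem_nhdsWithin).exists
    exact ⟨ε, hε0, hh1, hh2, hh3, hh4⟩
  -- ### the penalised functional and its maximum
  set pen : E → ℝ := fun x => (1 + ε * ‖x‖ ^ 2)⁻¹ with hpen
  have hpen_pos : ∀ x, 0 < pen x := fun x => by rw [hpen]; positivity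
  have hpen_le : ∀ x, pen x ≤ 1 := fun x => by
    rw [hpen]; exact inv_le_one_of_one_le₀ (by nlinarith [sq_nonneg ‖x‖, hε0])
  set ψ : ℝ × E × E → ℝ := fun z => w z.1 * (pen z.2.1 * ⟪W z.1 z.2.1 z.2.2, z.2.2⟫) / B z.1 with hψ
  have hψ₁ : 1 < ψ (t₁, x₁, e₁) := by
    have : ψ (t₁, x₁, e₁) = (1 + ε * ‖x₁‖ ^ 2)⁻¹ * v₁ := by
      simp only [hψ, hpen]; ring
    rw [this]; exact hpen₁
  -- outside a large ball the penalised value is `< 1`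
  set R : ℝ := Real.sqrt (K / (b * ε)) with hR
  have hout : ∀ t ∈ Icc 0 T, ∀ (x : E) (e : E), ‖e‖ = 1 → R ≤ ‖x‖ → ψ (t, x, e) < 1 := by
    intro t ht x e he hx
    have hBt : 0 < B t := hBpos t ht
    have hxsq : K / (b * ε) ≤ ‖x‖ ^ 2 := by
      have h0 : 0 ≤ K / (b * ε) := by positivity
      calc K / (b * ε) = R ^ 2 := by rw [hR, Real.sq_sqrt h0]
        _ ≤ ‖x‖ ^ 2 := pow_le_pow_left₀ (Real.sqrt_nonneg _) hx 2
    have hpenx : pen x * (b + K) ≤ b := by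
      have h1 : K / b ≤ ε * ‖x‖ ^ 2 := by
        rw [div_le_iff₀ hbpos]
        have := mul_le_mul_of_nonneg_left hxsq (le_of_lt (mul_pos hbpos hε0))
        rw [mul_div_cancel₀ _ (mul_pos hbpos hε0).ne'] at this
        nlinarith
      have h2 : (b + K) / b ≤ 1 + ε * ‖x‖ ^ 2 := by
        rw [add_div, div_self hbpos.ne']; linarith
      rw [hpen]
      calc (1 + ε * ‖x‖ ^ 2)⁻¹ * (b + K) ≤ ((b + K) / b)⁻¹ * (b + K) := by
            gcongr
        _ = b := by field_simp
    show w t * (pen x * ⟪W t x e, e⟫) / B t < 1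
    rcases le_or_gt 0 ⟪W t x e, e⟫ with hq | hq
    · have h3 : pen x * ⟪W t x e, e⟫ ≤ pen x * K := mul_le_mul_of_nonneg_left (hqK t ht x e he) (hpen_pos x).le
      have h4 : w t * (pen x * ⟪W t x e, e⟫) ≤ 1 * (pen x * K) :=
        mul_le_mul (hwle t ht) h3 (mul_nonneg (hpen_pos x).le hq) zero_le_one
      rw [div_lt_one hBt]
      have h5 : pen x * K < b := by
        have := hpen_pos x; nlinarith [hpenx]
      linarith [hBge t ht]
    · have : w t * (pen x * ⟪W t x e, e⟫) / B t < 0 :=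
        div_neg_of_neg_of_pos (mul_neg_of_pos_of_neg (hwpos t)
          (mul_neg_of_pos_of_neg (hpen_pos x) hq)) hBt
      linarith
  set R' : ℝ := max R ‖x₁‖ with hR'
  set Kc : Set (ℝ × E × E) := Icc 0 T ×ˢ (closedBall (0 : E) R' ×ˢ sphere (0 : E) 1) with hKc
  have hKcc : IsCompact Kc := isCompact_Icc.prod ((isCompact_closedBall _ _).prod (isCompact_sphere _ _))
  have h1K : (t₁, x₁, e₁) ∈ Kc := mk_mem_prod ht₁ (mk_mem_prod (by simp [hR']) (by simpa using he₁))
  have hψc : ContinuousOn ψ Kc := by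
    have hWc : ContinuousOn (fun z : ℝ × E × E => W z.1 z.2.1) Kc := by
      have h := hW.continuousOn
      have h2 : ContinuousOn (fun z : ℝ × E × E => (z.1, z.2.1)) Kc := by fun_prop
      exact h.comp h2 fun z hz => mk_mem_prod (mem_prod.mp hz).1 (mem_univ _)
    have hev : ContinuousOn (fun z : ℝ × E × E => W z.1 z.2.1 z.2.2) Kc :=
      isBoundedBilinearMap_apply.continuous.comp_continuousOn (hWc.prodMk (by fun_prop))
    have hin : ContinuousOn (fun z : ℝ × E × E => ⟪W z.1 z.2.1 z.2.2, z.2.2⟫) Kc :=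
      hev.inner (by fun_prop)
    have hpc : Continuous fun z : ℝ × E × E => pen z.2.1 := by
      simp only [hpen]
      exact Continuous.inv₀ (by fun_prop) fun z => by positivity
    have hec : Continuous fun z : ℝ × E × E => w z.1 := by fun_prop
    have hBK : ContinuousOn (fun z : ℝ × E × E => B z.1) Kc :=
      hBc.comp continuous_fst.continuousOn fun z hz => (mem_prod.mp hz).1
    exact (hec.continuousOn.mul (hpc.continuousOn.mul hin)).div hBK
      fun z hz => (hBpos z.1 (mem_prod.mp hz).1).ne'
  obtain ⟨⟨t₀, x₀, e₀⟩, h0K, hmaxK⟩ := hKcc.exists_isMaxOn ⟨(t₁, x₁, e₁), h1K⟩ hψc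
  have ht₀ : t₀ ∈ Icc 0 T := (mem_prod.mp h0K).1
  have he₀ : ‖e₀‖ = 1 := by
    have := (mem_prod.mp (mem_prod.mp h0K).2).2
    simpa using this
  have hB₀ : 0 < B t₀ := hBpos t₀ ht₀
  have hmax₁ : ψ (t₁, x₁, e₁) ≤ ψ (t₀, x₀, e₀) := isMaxOn_iff.mp hmaxK _ h1K
  have hglob : ∀ t ∈ Icc 0 T, ∀ (x : E) (e : E), ‖e‖ = 1 → ψ (t, x, e) ≤ ψ (t₀, x₀, e₀) := by
    intro t ht x e he
    by_cases hx : ‖x‖ ≤ R'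
    · exact isMaxOn_iff.mp hmaxK (t, x, e)
        (mk_mem_prod ht (mk_mem_prod (by simpa using hx) (by simpa using he)))
    · have hRx : R ≤ ‖x‖ := (le_max_left _ _).trans (not_le.mp hx).le
      exact ((hout t ht x e he hRx).trans hψ₁).le.trans hmax₁
  have hψ₀ : 1 < ψ (t₀, x₀, e₀) := hψ₁.trans_le hmax₁
  set q₀ : ℝ := ⟪W t₀ x₀ e₀, e₀⟫ with hq₀
  have hψ₀' : ψ (t₀, x₀, e₀) = w t₀ * (pen x₀ * q₀) / B t₀ := rfl
  -- `q₀ > 0`, `t₀ > 0`, `q₀ > B(t₀)`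
  have hq₀pos : 0 < q₀ := by
    by_contra hneg
    push Not at hneg
    have : ψ (t₀, x₀, e₀) ≤ 0 := by
      rw [hψ₀']
      exact div_nonpos_of_nonpos_of_nonneg (mul_nonpos_of_nonneg_of_nonpos (hwpos t₀).le
        (mul_nonpos_of_nonneg_of_nonpos (hpen_pos x₀).le hneg)) hB₀.le
    linarith
  have hwpq : w t₀ * (pen x₀ * q₀) ≤ q₀ := by
    calc w t₀ * (pen x₀ * q₀) ≤ 1 * (1 * q₀) :=
          mul_le_mul (hwle t₀ ht₀) (mul_le_mul_of_nonneg_right (hpen_le x₀) hq₀pos.le)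
            (mul_nonneg (hpen_pos x₀).le hq₀pos.le) zero_le_one
      _ = q₀ := by ring
  have ht₀pos : 0 < t₀ := by
    rcases ht₀.1.eq_or_lt with h | h
    · exfalso
      have hB00 : 0 < B 0 := hBpos 0 h0T
      have h1 : ψ (t₀, x₀, e₀) ≤ 1 := by
        rw [hψ₀', div_le_one hB₀]
        refine hwpq.trans ?_
        have hM0 := hM x₀ e₀ he₀
        rw [h] at hM0
        exact hM0
      linarith
    · exact h
  have hbig : B t₀ < q₀ := by
    have h1 : B t₀ < w t₀ * (pen x₀ * q₀) := by
      have := hψ₀; rw [hψ₀', lt_div_iff₀ hB₀, one_mul] at this; exact this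
    exact h1.trans_le hwpq
  -- the penalised-maximiser condition at `t₀`
  have hE : 0 < w t₀ / B t₀ := by positivity
  have hpmax : ∀ (x : E) (e : E), ‖e‖ = 1 →
      (1 + ε * ‖x‖ ^ 2)⁻¹ * ⟪W t₀ x e, e⟫ ≤ (1 + ε * ‖x₀‖ ^ 2)⁻¹ * q₀ := by
    intro x e he
    have h := hglob t₀ ht₀ x e he
    have h' : w t₀ / B t₀ * (pen x * ⟪W t₀ x e, e⟫) ≤ w t₀ / B t₀ * (pen x₀ * q₀) := by
      rw [div_mul_eq_mul_div, div_mul_eq_mul_div]; exact h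
    exact le_of_mul_le_mul_left h' hE
  -- the almost-maximiser condition at `t₀`
  have halmost : ∀ (x : E) (e : E), ‖e‖ = 1 → (1 - δ) * ⟪W t₀ x e, e⟫ ≤ q₀ := by
    intro x e he
    rcases le_or_gt ⟪W t₀ x e, e⟫ 0 with hq | hq
    · have : (1 - δ) * ⟪W t₀ x e, e⟫ ≤ 0 := mul_nonpos_of_nonneg_of_nonpos (by linarith) hq
      linarith
    -- `ψmax ≥ ψ(t₂,x₂,e₂) ≥ ρ(1−δ/2)S* = (1−δ)S* ≥ (1−δ)·w(t₀)q/B(t₀)`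
    have h2 : ψ (t₂, x₂, e₂) ≤ ψ (t₀, x₀, e₀) := hglob t₂ ht₂ x₂ e₂ he₂
    have hψ₂ : ψ (t₂, x₂, e₂) = pen x₂ * (w t₂ * ⟪W t₂ x₂ e₂, e₂⟫ / B t₂) := by
      simp only [hψ]; ring
    have hv₂pos : 0 < w t₂ * ⟪W t₂ x₂ e₂, e₂⟫ / B t₂ := by
      have : 0 < (1 - δ / 2) * Sstar := mul_pos (by linarith) hSpos
      linarith
    have h3 : (1 - δ) * Sstar ≤ ψ (t₂, x₂, e₂) := by
      rw [hψ₂]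
      have hρ2 : ρ * (1 - δ / 2) = 1 - δ := by
        have hne : (1 - δ / 2) ≠ 0 := by linarith
        rw [hρ, div_mul_cancel₀ _ hne]
      calc (1 - δ) * Sstar = ρ * ((1 - δ / 2) * Sstar) := by rw [← hρ2]; ring
        _ ≤ pen x₂ * (w t₂ * ⟪W t₂ x₂ e₂, e₂⟫ / B t₂) :=
            mul_le_mul hpen₂ hv₂.le (le_of_lt (mul_pos (by linarith) hSpos)) (hpen_pos x₂).le
    have h4 : ψ (t₀, x₀, e₀) ≤ w t₀ * q₀ / B t₀ := by
      rw [hψ₀']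
      refine div_le_div_of_nonneg_right ?_ hB₀.le
      have : pen x₀ * q₀ ≤ q₀ := by nlinarith [hpen_le x₀, hq₀pos]
      exact mul_le_mul_of_nonneg_left this (hwpos t₀).le
    have h5 : w t₀ * ⟪W t₀ x e, e⟫ / B t₀ ≤ Sstar := hVle t₀ ht₀ x e he
    have h6 : (1 - δ) * (w t₀ * ⟪W t₀ x e, e⟫ / B t₀) ≤ w t₀ * q₀ / B t₀ :=
      (mul_le_mul_of_nonneg_left h5 (by linarith)).trans (h3.trans (h2.trans h4))
    have h7 : w t₀ / B t₀ * ((1 - δ) * ⟪W t₀ x e, e⟫) ≤ w t₀ / B t₀ * q₀ := by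
      have e1 : (1 - δ) * (w t₀ * ⟪W t₀ x e, e⟫ / B t₀) = w t₀ / B t₀ * ((1 - δ) * ⟪W t₀ x e, e⟫) := by
        ring
      have e2 : w t₀ * q₀ / B t₀ = w t₀ / B t₀ * q₀ := by ring
      rw [e1, e2] at h6
      exact h6
    exact le_of_mul_le_mul_left h7 hE
  have hinner : ⟪timeDerivWithin (Icc 0 T) W t₀ x₀ e₀, e₀⟫ ≤ (φ t₀ + η ε) * q₀ :=
    hgrow ε hε0 hε1 t₀ ht₀ ht₀pos x₀ e₀ he₀ hpmax halmost hbig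
  -- ### one-sided Fermat in time
  have hγ : HasDerivWithinAt (fun s => W s x₀) (timeDerivWithin (Icc 0 T) W t₀ x₀) (Icc 0 T) t₀ := by
    rw [timeDerivWithin_apply]
    exact (hW.differentiableWithinAt_time ht₀ x₀).hasDerivWithinAt
  have hγe : HasDerivWithinAt (fun s => W s x₀ e₀) (timeDerivWithin (Icc 0 T) W t₀ x₀ e₀) (Icc 0 T) t₀ := by
    have h := hγ.clm_apply (hasDerivWithinAt_const t₀ (Icc 0 T) e₀)
    simpa using h
  have hq : HasDerivWithinAt (fun s => ⟪W s x₀ e₀, e₀⟫)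
      ⟪timeDerivWithin (Icc 0 T) W t₀ x₀ e₀, e₀⟫ (Icc 0 T) t₀ := by
    have h := hγe.inner ℝ (hasDerivWithinAt_const t₀ (Icc 0 T) e₀)
    simpa using h
  have hf : HasDerivWithinAt (fun s : ℝ => -(2 * εt * s)) (-(2 * εt)) (Icc 0 T) t₀ := by
    have h := ((hasDerivAt_id t₀).const_mul (2 * εt)).hasDerivWithinAt (s := Icc 0 T)
    simp only [id, mul_one] at h
    exact h.neg
  set I : ℝ := ⟪timeDerivWithin (Icc 0 T) W t₀ x₀ e₀, e₀⟫ with hI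
  have hnum : HasDerivWithinAt (fun s => w s * (pen x₀ * ⟪W s x₀ e₀, e₀⟫))
      (w t₀ * (-(2 * εt)) * (pen x₀ * q₀) + w t₀ * (pen x₀ * I)) (Icc 0 T) t₀ :=
    hf.exp.mul (hq.const_mul (pen x₀))
  have hk := hnum.div (hBd t₀ ht₀) hB₀.ne'
  have htime := derivWithin_Icc_nonneg_of_forall_le ht₀ ht₀pos hk
    (fun s hs => hglob s hs x₀ e₀ he₀)
  have hsup : φ t₀ * B t₀ ≤ B' t₀ := hsuper t₀ ht₀
  have hnumneg : (w t₀ * (-(2 * εt)) * (pen x₀ * q₀) + w t₀ * (pen x₀ * I)) * B t₀ -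
      w t₀ * (pen x₀ * q₀) * B' t₀ < 0 := by
    have hw0 := hwpos t₀
    have hp0 := hpen_pos x₀
    -- `= w·pen·[(−2εt q₀ + I)B − q₀B']`, and `I B ≤ (φ + ηε) q₀ B ≤ q₀ B' + ηε q₀ B`
    have h1 : I * B t₀ ≤ (φ t₀ + η ε) * q₀ * B t₀ := mul_le_mul_of_nonneg_right hinner hB₀.le
    have h2 : φ t₀ * q₀ * B t₀ ≤ q₀ * B' t₀ := by
      have := mul_le_mul_of_nonneg_left hsup hq₀pos.le
      linarith
    have h3 : (-(2 * εt) * q₀ + I) * B t₀ - q₀ * B' t₀ < 0 := by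
      have h4 : 0 < (εt - η ε) * q₀ * B t₀ := by
        have : 0 < εt - η ε := by linarith
        positivity
      nlinarith [h1, h2, h4]
    have h5 : (w t₀ * (-(2 * εt)) * (pen x₀ * q₀) + w t₀ * (pen x₀ * I)) * B t₀ -
        w t₀ * (pen x₀ * q₀) * B' t₀ =
        (w t₀ * pen x₀) * ((-(2 * εt) * q₀ + I) * B t₀ - q₀ * B' t₀) := by ring
    rw [h5]
    exact mul_neg_of_pos_of_neg (mul_pos hw0 hp0) h3
  have hderiv_neg : ((w t₀ * (-(2 * εt)) * (pen x₀ * q₀) + w t₀ * (pen x₀ * I)) * B t₀ -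
      w t₀ * (pen x₀ * q₀) * B' t₀) / B t₀ ^ 2 < 0 :=
    div_neg_of_neg_of_pos hnumneg (by positivity)
  exact absurd htime (not_le.2 hderiv_neg)

end AbstractStrainAlmost

end Summit.NavierStokesRegularity.NavierStokesRegularity.Theorems.ArgmaxDoors

end
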